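import Summits.QuantumFields.YangMills.Theorems.IsotropyFromPowerCountingCurvatureSandwichBoundIterSchwarz
import Summits.QuantumFields.YangMills.Theorems.IsotropyFromPowerCountingCurvatureSandwichBoundChainOrdered
import Summits.QuantumFields.YangMills.Theorems.IsotropyFromPowerCountingCurvatureSandwichBoundSandwichAdjoint

/-!
# `CurvatureSandwichBound` (Σ), line `Sketch`: the multiple-reflection ENGINE — chain growth ⟺ the sandwich row

Support file for crux stmt-QuantumFields-18372 (`IsotropyFromPowerCounting.CurvatureSandwichBound`), registered
skeleton `Cruxes/CurvatureSandwichBound/Lines/Sketch.lean` (lead prover-line-stmt-QuantumFields-18372-0).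

Fix a one-species family `S` on `ℝ⁴` with an `e₀`-reconstruction `h : OSReconstructionNoE1 S.toLabelled` (E2 +
translations on `⁰𝒮`, nothing else), a windowed insertion `f₁` (`tsupport f₁ ⊆ {u ≤ x⁰ ≤ 2u}`), `s = 2u + v`, the
sandwich `X G := f₁ ⊗ T_s G`, its formal adjoint `X♯ F := T_s (f₁† ⊗ F)` (`f₁† = osAdjoint f₁`) and the chain step
`P := X♯X`, `P G = T_s (f₁† ⊗ f₁ ⊗ T_s G)`, iterated on `Σ m, 𝓢((ℝ⁴)^m)` (written as a variable `P` with its defining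
equation `hP`, so that no definition is posited).

* `sandwich_of_chainGrowth` (**the engine**, Glimm–Jaffe 1987 Thm 10.5.5 in signed, vector-end form): if the chain
  moments `Re 𝔖(ΘW* ⊗ P^N W)` are `≤ C_W Λ^{2N}` for all `N`, then `‖Ψ_{XW}‖ ≤ Λ ‖Ψ_W‖` — iterated Schwarz
  (`stub_iterSchwarz`) on `p_k = Ψ_{P^k W}`, using `‖p_k‖² = ⟨Ψ_W, p_{2k}⟩` (`inner_iterate`, from the sandwich adjoint
  identity `stub_sandwichAdjoint`) and admissibility of all iterates (`adm_iterate`, from `stub_chainOrdered`).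
* `pairScale_nonneg`, `tsupport_subset_window`: bookkeeping for the row's data.

The converse (the row gives chain growth back) and the equivalence with the item BY NAME are the companion file
`…CurvatureSandwichBoundChainGrowthIff.lean`: the Yang–Mills content of Σ is EXACTLY a growth-rate bound for one
explicit family of Schwinger functions.

References: J. Glimm, A. Jaffe, *Quantum Physics* (2nd ed. 1987), §10.5, Thm 10.5.5 (multiple reflections);
K. Osterwalder, R. Schrader, CMP 31 (1973) §4.1 (4.7).
-/

noncomputable section

namespace Summit.QuantumFields.YangMills.Theorems.CurvatureSandwichBound.Sketch

open scoped BigOperators SchwartzMap InnerProductSpace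
open MeasureTheory Filter Topology
open Literature.MathematicalPhysics.QuantumLattice Literature.MathematicalPhysics.AQFT
  Literature.MathematicalPhysics.QuantumFieldTheory Literature.Probability.LatticeModels
open Summit.QuantumFields.YangMills.Theorems.NPointIsotropy.Negative (E4)

/-- Support of the windowed insertion: `f₁ = g ⊗ hh` with `g` vanishing off the time window
`[u, 2u]` has `tsupport f₁ ⊆ {u ≤ x⁰ ≤ 2u}`. -/
theorem tsupport_subset_window {u : ℝ} {f₁ : 𝓢((Fin 1 → E4), ℂ)} {g hh : ℝ × ℝ → ℂ}
    (hf₁ : ∀ x : Fin 1 → E4, f₁ x = g (x 0 0, x 0 1) * hh (x 0 2, x 0 3))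
    (hg : ∀ p : ℝ × ℝ, g p ≠ 0 → u ≤ p.1 ∧ p.1 ≤ 2 * u) :
    tsupport (f₁ : (Fin 1 → E4) → ℂ) ⊆ {x | u ≤ x 0 0 ∧ x 0 0 ≤ 2 * u} := by
  refine closure_minimal (fun x hx => ?_) ?_
  · rw [Function.mem_support, hf₁ x] at hx
    exact hg _ (left_ne_zero_of_mul hx)
  · have hc : Continuous fun x : Fin 1 → E4 => x 0 0 :=
      (EuclideanSpace.proj (0 : Fin 4)).continuous.comp (continuous_apply 0)
    exact (isClosed_le continuous_const hc).inter (isClosed_le hc continuous_const)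

/-- Field vectors of equal generators (as points of `Σ m, 𝓢((ℝ⁴)^m)`) are equal. -/
theorem fieldVec_sigma_congr {S : SchwingerFamily E4} (h : OSReconstructionNoE1 S.toLabelled)
    {A B : Σ m : ℕ, 𝓢((Fin m → E4), ℂ)} (hAB : A = B) (hA : IsTimeOrdered A.2)
    (hB : IsTimeOrdered B.2) :
    h.fieldVec A.1 (fun _ => ()) A.2 hA = h.fieldVec B.1 (fun _ => ()) B.2 hB := by
  subst hAB
  rfl

/-- **Admissibility propagates along the chain**: every iterate `P^N A` of an admissible `A`
(`A` and `X A` time-ordered) is admissible. -/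
theorem adm_iterate (u v : ℝ) (hu : 0 < u) (hv : 0 < v) (f₁ : 𝓢((Fin 1 → E4), ℂ))
    (hf₁ : tsupport (f₁ : (Fin 1 → E4) → ℂ) ⊆ {x | u ≤ x 0 0 ∧ x 0 0 ≤ 2 * u})
    (P : (Σ m : ℕ, 𝓢((Fin m → E4), ℂ)) → (Σ m : ℕ, 𝓢((Fin m → E4), ℂ)))
    (hP : P = fun Gσ => ⟨1 + (1 + Gσ.1), translateMulti ((2 * u + v) • EuclideanSpace.single 0 1)
      ((osAdjoint f₁).appendTensor
        (f₁.appendTensor (translateMulti ((2 * u + v) • EuclideanSpace.single 0 1) Gσ.2)))⟩)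
    (N : ℕ) (A : Σ m : ℕ, 𝓢((Fin m → E4), ℂ))
    (hXA : IsTimeOrdered
      (f₁.appendTensor (translateMulti ((2 * u + v) • EuclideanSpace.single 0 1) A.2))) :
    IsTimeOrdered (P^[N + 1] A).2 ∧
      IsTimeOrdered
        (f₁.appendTensor (translateMulti ((2 * u + v) • EuclideanSpace.single 0 1) (P^[N + 1] A).2)) := by
  subst hP
  induction N generalizing A with
  | zero => exact stub_chainOrdered u v hu hv f₁ hf₁ A.2 hXA
  | succ N ih =>
    rw [Function.iterate_succ_apply]
    exact ih _ (stub_chainOrdered u v hu hv f₁ hf₁ A.2 hXA).2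

/-- Admissibility of all iterates, including `N = 0`. -/
theorem adm_iterate' (u v : ℝ) (hu : 0 < u) (hv : 0 < v) (f₁ : 𝓢((Fin 1 → E4), ℂ))
    (hf₁ : tsupport (f₁ : (Fin 1 → E4) → ℂ) ⊆ {x | u ≤ x 0 0 ∧ x 0 0 ≤ 2 * u})
    (P : (Σ m : ℕ, 𝓢((Fin m → E4), ℂ)) → (Σ m : ℕ, 𝓢((Fin m → E4), ℂ)))
    (hP : P = fun Gσ => ⟨1 + (1 + Gσ.1), translateMulti ((2 * u + v) • EuclideanSpace.single 0 1)
      ((osAdjoint f₁).appendTensor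
        (f₁.appendTensor (translateMulti ((2 * u + v) • EuclideanSpace.single 0 1) Gσ.2)))⟩)
    (N : ℕ) (A : Σ m : ℕ, 𝓢((Fin m → E4), ℂ)) (hA : IsTimeOrdered A.2)
    (hXA : IsTimeOrdered
      (f₁.appendTensor (translateMulti ((2 * u + v) • EuclideanSpace.single 0 1) A.2))) :
    IsTimeOrdered (P^[N] A).2 ∧
      IsTimeOrdered
        (f₁.appendTensor (translateMulti ((2 * u + v) • EuclideanSpace.single 0 1) (P^[N] A).2)) := by
  cases N with
  | zero => exact ⟨hA, hXA⟩
  | succ N => exact adm_iterate u v hu hv f₁ hf₁ P hP N A hXA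

/-- **`P = X♯X` is formally symmetric on admissible field vectors**: `⟨Ψ_{PA}, Ψ_B⟩ = ⟨Ψ_A, Ψ_{PB}⟩`
(two applications of the sandwich adjoint identity and hermitian symmetry of the inner product). -/
theorem inner_P_symm (S : SchwingerFamily E4) (h : OSReconstructionNoE1 S.toLabelled)
    (s : ℝ) (f₁ : 𝓢((Fin 1 → E4), ℂ))
    (P : (Σ m : ℕ, 𝓢((Fin m → E4), ℂ)) → (Σ m : ℕ, 𝓢((Fin m → E4), ℂ)))
    (hP : P = fun Gσ => ⟨1 + (1 + Gσ.1), translateMulti (s • EuclideanSpace.single 0 1)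
      ((osAdjoint f₁).appendTensor
        (f₁.appendTensor (translateMulti (s • EuclideanSpace.single 0 1) Gσ.2)))⟩)
    (A B : Σ m : ℕ, 𝓢((Fin m → E4), ℂ)) (hA : IsTimeOrdered A.2) (hB : IsTimeOrdered B.2)
    (hXA : IsTimeOrdered (f₁.appendTensor (translateMulti (s • EuclideanSpace.single 0 1) A.2)))
    (hXB : IsTimeOrdered (f₁.appendTensor (translateMulti (s • EuclideanSpace.single 0 1) B.2)))
    (hPA : IsTimeOrdered (P A).2) (hPB : IsTimeOrdered (P B).2) :
    ⟪h.fieldVec (P A).1 (fun _ => ()) (P A).2 hPA, h.fieldVec B.1 (fun _ => ()) B.2 hB⟫_ℂ =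
      ⟪h.fieldVec A.1 (fun _ => ()) A.2 hA, h.fieldVec (P B).1 (fun _ => ()) (P B).2 hPB⟫_ℂ := by
  subst hP
  have h1 := stub_sandwichAdjoint S h s f₁ B.2 A.2 hB hXB hXA hPA
  have h2 := stub_sandwichAdjoint S h s f₁ A.2 B.2 hA hXA hXB hPB
  rw [← inner_conj_symm, ← h1, inner_conj_symm, h2]

/-- **Chain inner products collapse to one end**: `⟨Ψ_{P^i A}, Ψ_{P^j A}⟩ = ⟨Ψ_A, Ψ_{P^{i+j} A}⟩`. -/
theorem inner_iterate (S : SchwingerFamily E4) (h : OSReconstructionNoE1 S.toLabelled)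
    (u v : ℝ) (hu : 0 < u) (hv : 0 < v) (f₁ : 𝓢((Fin 1 → E4), ℂ))
    (hf₁ : tsupport (f₁ : (Fin 1 → E4) → ℂ) ⊆ {x | u ≤ x 0 0 ∧ x 0 0 ≤ 2 * u})
    (P : (Σ m : ℕ, 𝓢((Fin m → E4), ℂ)) → (Σ m : ℕ, 𝓢((Fin m → E4), ℂ)))
    (hP : P = fun Gσ => ⟨1 + (1 + Gσ.1), translateMulti ((2 * u + v) • EuclideanSpace.single 0 1)
      ((osAdjoint f₁).appendTensor
        (f₁.appendTensor (translateMulti ((2 * u + v) • EuclideanSpace.single 0 1) Gσ.2)))⟩)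
    (A : Σ m : ℕ, 𝓢((Fin m → E4), ℂ)) (hA : IsTimeOrdered A.2)
    (hXA : IsTimeOrdered
      (f₁.appendTensor (translateMulti ((2 * u + v) • EuclideanSpace.single 0 1) A.2)))
    (i j : ℕ) :
    ⟪h.fieldVec (P^[i] A).1 (fun _ => ()) (P^[i] A).2
        (adm_iterate' u v hu hv f₁ hf₁ P hP i A hA hXA).1,
      h.fieldVec (P^[j] A).1 (fun _ => ()) (P^[j] A).2
        (adm_iterate' u v hu hv f₁ hf₁ P hP j A hA hXA).1⟫_ℂ =
    ⟪h.fieldVec A.1 (fun _ => ()) A.2 hA,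
      h.fieldVec (P^[i + j] A).1 (fun _ => ()) (P^[i + j] A).2
        (adm_iterate' u v hu hv f₁ hf₁ P hP (i + j) A hA hXA).1⟫_ℂ := by
  induction i generalizing j with
  | zero =>
    congr 1
    exact fieldVec_sigma_congr h (by rw [Nat.zero_add]) _ _
  | succ i ih =>
    -- `P^[i+1] A = P (P^[i] A)` and `P (P^[j] A) = P^[j+1] A`
    have hi : P^[i + 1] A = P (P^[i] A) := Function.iterate_succ_apply' P i A
    have hj : P (P^[j] A) = P^[j + 1] A := (Function.iterate_succ_apply' P j A).symm
    have hij : P^[i + (j + 1)] A = P^[i + 1 + j] A := by rw [Nat.add_right_comm, Nat.add_assoc]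
    have hAi := adm_iterate' u v hu hv f₁ hf₁ P hP i A hA hXA
    have hAj := adm_iterate' u v hu hv f₁ hf₁ P hP j A hA hXA
    have hPAi : IsTimeOrdered (P (P^[i] A)).2 :=
      hi ▸ (adm_iterate' u v hu hv f₁ hf₁ P hP (i + 1) A hA hXA).1
    have hPAj : IsTimeOrdered (P (P^[j] A)).2 :=
      hj ▸ (adm_iterate' u v hu hv f₁ hf₁ P hP (j + 1) A hA hXA).1
    rw [fieldVec_sigma_congr h hi _ hPAi,
      inner_P_symm S h (2 * u + v) f₁ P hP (P^[i] A) (P^[j] A) hAi.1 hAj.1 hAi.2 hAj.2 hPAi hPAj,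
      fieldVec_sigma_congr h hj hPAj (adm_iterate' u v hu hv f₁ hf₁ P hP (j + 1) A hA hXA).1, ih (j + 1),
      fieldVec_sigma_congr h hij _ _]

/-- **THE ENGINE (E3).**  For any one-species family `S` on `ℝ⁴` with an `e₀`-reconstruction `h`,
a windowed insertion `f₁` (`supp ⊆ {u ≤ x⁰ ≤ 2u}`), `s = 2u + v`, `Λ ≥ 0` and an admissible
time-ordered `W`: if the chain moments `Re 𝔖(ΘW* ⊗ P^N W)` are `≤ C_W Λ^{2N}` for all `N`
(`P G = T_s(f₁† ⊗ f₁ ⊗ T_s G)`, iterated on `Σ m, 𝓢((ℝ⁴)^m)`), then `‖Ψ_{f₁ ⊗ T_s W}‖ ≤ Λ ‖Ψ_W‖`. -/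
theorem sandwich_of_chainGrowth (S : SchwingerFamily E4) (h : OSReconstructionNoE1 S.toLabelled)
    (u v : ℝ) (hu : 0 < u) (hv : 0 < v) (f₁ : 𝓢((Fin 1 → E4), ℂ))
    (hf₁ : tsupport (f₁ : (Fin 1 → E4) → ℂ) ⊆ {x | u ≤ x 0 0 ∧ x 0 0 ≤ 2 * u})
    (Λ : ℝ) (hΛ : 0 ≤ Λ) {n : ℕ} (W : 𝓢((Fin n → E4), ℂ)) (hW : IsTimeOrdered W)
    (hFW : IsTimeOrdered
      (f₁.appendTensor (translateMulti ((2 * u + v) • EuclideanSpace.single 0 1) W)))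
    (CW : ℝ) (hCW : 0 ≤ CW)
    (P : (Σ m : ℕ, 𝓢((Fin m → E4), ℂ)) → (Σ m : ℕ, 𝓢((Fin m → E4), ℂ)))
    (hP : P = fun Gσ => ⟨1 + (1 + Gσ.1), translateMulti ((2 * u + v) • EuclideanSpace.single 0 1)
      ((osAdjoint f₁).appendTensor
        (f₁.appendTensor (translateMulti ((2 * u + v) • EuclideanSpace.single 0 1) Gσ.2)))⟩)
    (hchain : ∀ N : ℕ,
      (S (n + (P^[N] ⟨n, W⟩).1) ((osAdjoint W).appendTensor (P^[N] ⟨n, W⟩).2)).re ≤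
        CW * Λ ^ (2 * N)) :
    ‖h.fieldVec (1 + n) (fun _ => ())
        (f₁.appendTensor (translateMulti ((2 * u + v) • EuclideanSpace.single 0 1) W)) hFW‖ ≤
      Λ * ‖h.fieldVec n (fun _ => ()) W hW‖ := by
  -- admissibility of every iterate of `A₀ = ⟨n, W⟩`
  have hadm : ∀ k : ℕ, IsTimeOrdered (P^[k] ⟨n, W⟩).2 ∧
      IsTimeOrdered (f₁.appendTensor
        (translateMulti ((2 * u + v) • EuclideanSpace.single 0 1) (P^[k] ⟨n, W⟩).2)) :=
    fun k => adm_iterate' u v hu hv f₁ hf₁ P hP k ⟨n, W⟩ hW hFW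
  -- the chain vectors `p k = Ψ_{P^k W}` (`p 0 = Ψ_W`) and the sandwich vector `y = Ψ_{XW}`
  let p : ℕ → h.Hilbert := fun k =>
    h.fieldVec (P^[k] ⟨n, W⟩).1 (fun _ => ()) (P^[k] ⟨n, W⟩).2 (hadm k).1
  have hp0 : p 0 = h.fieldVec n (fun _ => ()) W hW := rfl
  -- chain moments are the inner products `⟪p 0, p k⟫`
  have hinner : ∀ k : ℕ, ⟪p 0, p k⟫_ℂ =
      S (n + (P^[k] ⟨n, W⟩).1) ((osAdjoint W).appendTensor (P^[k] ⟨n, W⟩).2) := fun k =>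
    h.inner_fieldVec_fieldVec (fun _ => ()) (fun _ => ()) hW (hadm k).1
      (isAppendTensorOf_appendTensor _ _)
  -- `⟪p i, p j⟫ = ⟪p 0, p (i + j)⟫`
  have hij : ∀ i j : ℕ, ⟪p i, p j⟫_ℂ = ⟪p 0, p (i + j)⟫_ℂ := fun i j =>
    inner_iterate S h u v hu hv f₁ hf₁ P hP ⟨n, W⟩ hW hFW i j
  -- `‖p k‖² = Re ⟪p 0, p (2k)⟫`
  have hnorm : ∀ k : ℕ, ‖p k‖ ^ 2 = (⟪p 0, p (2 * k)⟫_ℂ).re := fun k => by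
    rw [two_mul, ← hij k k, ← inner_self_eq_norm_sq (𝕜 := ℂ) (p k)]
    rfl
  -- `‖y‖² = Re ⟪p 0, p 1⟫`
  have hy : ‖h.fieldVec (1 + n) (fun _ => ())
        (f₁.appendTensor (translateMulti ((2 * u + v) • EuclideanSpace.single 0 1) W)) hFW‖ ^ 2 =
      (⟪p 0, p 1⟫_ℂ).re := by
    have h1 : P^[1] ⟨n, W⟩ = P ⟨n, W⟩ := rfl
    have hPW : IsTimeOrdered (translateMulti ((2 * u + v) • EuclideanSpace.single 0 1)
        ((osAdjoint f₁).appendTensor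
          (f₁.appendTensor (translateMulti ((2 * u + v) • EuclideanSpace.single 0 1) W)))) := by
      have := (hadm 1).1
      rw [h1, hP] at this
      exact this
    have hsa := stub_sandwichAdjoint S h (2 * u + v) f₁ W W hW hFW hFW hPW
    have hp1 : p 1 = h.fieldVec (1 + (1 + n)) (fun _ => ())
        (translateMulti ((2 * u + v) • EuclideanSpace.single 0 1)
          ((osAdjoint f₁).appendTensor
            (f₁.appendTensor (translateMulti ((2 * u + v) • EuclideanSpace.single 0 1) W)))) hPW := by
      show h.fieldVec (P^[1] ⟨n, W⟩).1 (fun _ => ()) (P^[1] ⟨n, W⟩).2 (hadm 1).1 = _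
      exact fieldVec_sigma_congr h (A := P^[1] ⟨n, W⟩)
        (B := ⟨1 + (1 + n), translateMulti ((2 * u + v) • EuclideanSpace.single 0 1)
          ((osAdjoint f₁).appendTensor
            (f₁.appendTensor (translateMulti ((2 * u + v) • EuclideanSpace.single 0 1) W)))⟩)
        (by rw [h1, hP]) _ _
    rw [hp0, hp1, ← hsa, ← inner_self_eq_norm_sq (𝕜 := ℂ)]
    rfl
  -- the three inputs of the abstract iterated Schwarz bound
  have hre : ∀ k : ℕ, (⟪p 0, p k⟫_ℂ).re ≤ ‖p 0‖ * ‖p k‖ := fun k => by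
    simpa only [RCLike.re_to_complex] using re_inner_le_norm (𝕜 := ℂ) (p 0) (p k)
  have H1 : ‖h.fieldVec (1 + n) (fun _ => ())
        (f₁.appendTensor (translateMulti ((2 * u + v) • EuclideanSpace.single 0 1) W)) hFW‖ ^ 2 ≤
      ‖p 0‖ * ‖p 1‖ := hy ▸ hre 1
  have H2 : ∀ k : ℕ, ‖p k‖ ^ 2 ≤ ‖p 0‖ * ‖p (2 * k)‖ := fun k => (hnorm k) ▸ hre (2 * k)
  have H3 : ∀ k : ℕ, ‖p k‖ ≤ Real.sqrt CW * Λ ^ (2 * k) := fun k => by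
    have hsq : ‖p k‖ ^ 2 ≤ CW * Λ ^ (2 * (2 * k)) := by
      rw [hnorm k, hinner (2 * k)]
      exact hchain (2 * k)
    have hΛk : 0 ≤ Λ ^ (2 * k) := pow_nonneg hΛ _
    calc ‖p k‖ = Real.sqrt (‖p k‖ ^ 2) := (Real.sqrt_sq (norm_nonneg _)).symm
      _ ≤ Real.sqrt (CW * Λ ^ (2 * (2 * k))) := Real.sqrt_le_sqrt hsq
      _ = Real.sqrt CW * Λ ^ (2 * k) := by
        rw [Real.sqrt_mul hCW, show Λ ^ (2 * (2 * k)) = (Λ ^ (2 * k)) ^ 2 by ring,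
          Real.sqrt_sq hΛk]
  have key := stub_iterSchwarz (p 0) _ p (Real.sqrt CW) Λ (Real.sqrt_nonneg _) hΛ H1 H2 H3
  rwa [hp0] at key

/-- The pair scale `Λ = C·Mg·(Mh+Mh')·(u^{-μ}+v^{-μ})` is nonnegative under the row's hypotheses. -/
theorem pairScale_nonneg {C Mg Mh Mh' u v μ : ℝ} (hC : 0 ≤ C) (hu : 0 < u) (hv : 0 < v)
    {g hh : ℝ × ℝ → ℂ} (hMg : (∫ p, ‖g p‖) ≤ Mg) (hMh : (∫ p, ‖hh p‖) ≤ Mh)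
    (hMh' : ∀ p, ‖hh p‖ ≤ Mh') :
    0 ≤ C * Mg * (Mh + Mh') * (u ^ (-μ) + v ^ (-μ)) := by
  have hMg0 : 0 ≤ Mg := (integral_nonneg fun _ => norm_nonneg _).trans hMg
  have hMh0 : 0 ≤ Mh := (integral_nonneg fun _ => norm_nonneg _).trans hMh
  have hMh'0 : 0 ≤ Mh' := (norm_nonneg _).trans (hMh' 0)
  have hr : 0 ≤ u ^ (-μ) + v ^ (-μ) := add_nonneg (Real.rpow_nonneg hu.le _) (Real.rpow_nonneg hv.le _)
  positivity

/-- The `N = 0` chain moment is the squared norm of the spectator: `Re 𝔖(ΘW* ⊗ W) = ‖Ψ_W‖²`. -/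
theorem re_pairing_self_eq_norm_sq (S : SchwingerFamily E4) (h : OSReconstructionNoE1 S.toLabelled)
    {n : ℕ} (W : 𝓢((Fin n → E4), ℂ)) (hW : IsTimeOrdered W) :
    (S (n + n) ((osAdjoint W).appendTensor W)).re = ‖h.fieldVec n (fun _ => ()) W hW‖ ^ 2 := by
  rw [← inner_self_eq_norm_sq (𝕜 := ℂ),
    h.inner_fieldVec_fieldVec (fun _ => ()) (fun _ => ()) hW hW (isAppendTensorOf_appendTensor _ _)]
  rfl

end Summit.QuantumFields.YangMills.Theorems.CurvatureSandwichBound.Sketch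

end
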